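import Mathlib.Analysis.InnerProductSpace.Calculus
import Mathlib.Analysis.SpecialFunctions.Log.Deriv
import Mathlib.MeasureTheory.Integral.IntervalIntegral.IntegrationByParts
import Mathlib.MeasureTheory.Integral.IntegralEqImproper
import HarnessLib

/-!
# The logarithmic Hardy inequality behind Lei–Zhang 2017, Cor. 1.3 (one space dimension)

Analysis/FluidPDE proof file (no definitions, no named facts, no `sorry`) on the discharge path of
the named fact `Literature.Analysis.FluidPDE.LeiZhang2017_logModulus_regularity`
(`LeiZhang2017AxisymmetricCriteria.lean`; Z. Lei, Q. S. Zhang, *Criticality of the axially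
symmetric Navier–Stokes equations*, Pacific J. Math. 289 (2017) 169–187 = arXiv:1505.02628).

The proof of Cor. 1.3 (end of §2, arXiv p. 7) rests on one real-variable inequality, obtained there
by an integration by parts in the radial variable:

> "Using integration by parts, one has
> `∫ (r²|ln r|²)⁻¹ |φ(r/δ) f|² r dr dz = ∫ |φ(r/δ) f|² d|ln r|⁻¹ dz = ∫ |ln r|⁻¹ φ f ∂ᵣ[φ f] dr dz`
> `≤ ½ ∫ (r²|ln r|²)⁻¹ |φ f|² r dr dz + ½ ∫ |∂ᵣ[φ f]|² r dr dz`.  Hence, we have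
> `∫ (r²|ln r|²)⁻¹ |φ(r/δ) f|² r dr dz ≤ ∫ |∂ᵣ[φ(r/δ) f]|² r dr dz`."

This is the critical (logarithmic) Hardy–Leray inequality on `(0, a)`, `a < 1`.  This file proves
it for `C¹` functions `h : ℝ → F` with values in a real inner product space (so that it applies
verbatim to vector fields, componentwise or not), keeping the boundary term at `r = a` so that no
cut-off is needed:

* `logHardy_trunc`: for `0 < ε ≤ a < 1`,
  `∫_ε^a ‖h‖²/(r log² r) dr ≤ 2‖h(a)‖²/|log a| + 4 ∫_ε^a ‖h'‖² r dr`;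
* `logHardy`: the integrand `‖h‖²/(r log² r)` is integrable on `(0, a)` and
  `∫_0^a ‖h‖²/(r log² r) dr ≤ 2‖h(a)‖²/|log a| + 4 ∫_0^a ‖h'‖² r dr`;
* `logHardy_of_eq_zero`: the printed form (no boundary term) when `h a = 0`;
* `lintegral_logHardy`: the same in `ℝ≥0∞` (the currency of the tree's energy estimates).

**On the constant.** The printed computation drops the factor `2` of `d|φf|² = 2 φf ∂ᵣ(φf) dr`;
with it the same argument gives the constant `4` (`= (2/(2−p))^p` at the critical exponent of the
two-dimensional Hardy–Leray inequality, which is sharp), not `1`.  This is immaterial for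
Cor. 1.3, whose statement allows an arbitrary constant `C₁` (the form boundedness constant
becomes `C_* = 16 C₁` instead of `4 C₁`), and it is the constant `4` that is proved here.

## Proof

With `G(r) = −(log r)⁻¹ = |log r|⁻¹` (`G' = (r log² r)⁻¹` on `(0, 1)`, `hasDerivAt_neg_inv_log`)
and `u = ‖h‖²` (`u' = 2⟪h, h'⟫`), integration by parts on `[ε, a]` gives
`∫_ε^a u G' = u(a)G(a) − u(ε)G(ε) − ∫_ε^a 2⟪h, h'⟫ G ≤ ‖h(a)‖²/|log a| + ∫_ε^a 2‖h‖‖h'‖/|log r|`,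
and pointwise `2‖h‖‖h'‖/|log r| ≤ ½ ‖h‖²/(r log² r) + 2‖h'‖² r` (`two_mul_mul_div_le`, i.e.
`0 ≤ (‖h‖ − 2‖h'‖ r |log r|)²`); absorbing half of the left side proves `logHardy_trunc`.  The
bound is uniform in `ε`, so the (nonnegative) integrand is integrable on `(0, a)`
(`integrableOn_Ioc_of_intervalIntegral_norm_bounded_left`) and the inequality passes to the limit
`ε → 0⁺` by continuity of the primitive (`intervalIntegral.continuousOn_primitive_interval_left`).

## Mathlib / tree search

Mathlib has no Hardy inequality of this kind.  The tree has the regularised, scale-covariant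
logarithmic Hardy inequality of the Kerr decay estimates,
`Literature.Analysis.Calculus.hardy_log_core` (`HardyLogarithmic.lean`:
`∫₀ˢ f²/(x (1 − log(x/s))²) ≤ 2 f(s)² + 4 ∫₀ˢ x f'²` for real `f ∈ C¹[0, s]`), whose weight
coincides with the present one exactly when `s = e⁻¹`; the version here is for every `a ∈ (0, 1)`
(boundary term `2‖h a‖²/|log a|`), for inner-product-space-valued `h` (vector fields), and comes
with the `ℝ≥0∞` form consumed by the tree's energy estimates.  Used from Mathlib:
`intervalIntegral.integral_mul_deriv_eq_deriv_mul`, `HasDerivAt.norm_sq`, `Real.hasDerivAt_log`,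
`HasDerivAt.inv`, `integrableOn_Ioc_of_intervalIntegral_norm_bounded_left`,
`intervalIntegral.continuousOn_primitive_interval_left`, `ofReal_integral_eq_lintegral_ofReal`.

## References

* Z. Lei, Q. S. Zhang, Pacific J. Math. 289 (2017) 169–187, arXiv:1505.02628, proof of Cor. 1.3
  (end of §2, arXiv p. 7). [`LeiZhang2017`]
* J. Leray, *Étude de diverses équations intégrales non linéaires*, J. Math. Pures Appl. 12
  (1933), 1–82 (the two-dimensional inequality `∫ |u|²/(|x|² log²|x|) ≤ 4 ∫ |∇u|²`).
-/

noncomputable section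

open MeasureTheory Set Filter Topology intervalIntegral
open scoped RealInnerProductSpace ENNReal

namespace Literature.Analysis.FluidPDE

variable {F : Type*} [NormedAddCommGroup F] [InnerProductSpace ℝ F]

/-! ### Real-variable tools -/

/-- On `(0, 1) ∪ (1, ∞)` the function `G(r) = −(log r)⁻¹` has derivative `r⁻¹/(log r)²`
(for `0 < r < 1`, `G = |log r|⁻¹` is the primitive of the log-Hardy weight `(r log² r)⁻¹`;
Lei–Zhang 2017, p. 7: "`(r²|ln r|²)⁻¹ r dr = d|ln r|⁻¹`"). [cite: LeiZhang2017, proof of Cor. 1.3 (arXiv p. 7)] -/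
theorem hasDerivAt_neg_inv_log {r : ℝ} (hr0 : 0 < r) (hr1 : r ≠ 1) :
    HasDerivAt (fun s => -(Real.log s)⁻¹) (r⁻¹ / Real.log r ^ 2) r := by
  have hlog : Real.log r ≠ 0 := Real.log_ne_zero_of_pos_of_ne_one hr0 hr1
  have h := ((Real.hasDerivAt_log hr0.ne').inv hlog).neg
  refine h.congr_deriv ?_
  field_simp

/-- **Young's inequality in the form that absorbs the cross term of the integration by parts**:
for `r, L > 0`, `2 X Y / L ≤ X²/(2 r L²) + 2 Y² r` (it is `0 ≤ (X − 2 Y r L)²/(2 r L²)`).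
[folklore] -/
theorem two_mul_mul_div_le {X Y r L : ℝ} (hr : 0 < r) (hL : 0 < L) :
    2 * X * Y / L ≤ X ^ 2 / (2 * r * L ^ 2) + 2 * Y ^ 2 * r := by
  have key : X ^ 2 / (2 * r * L ^ 2) + 2 * Y ^ 2 * r - 2 * X * Y / L =
      (X - 2 * Y * r * L) ^ 2 / (2 * r * L ^ 2) := by
    field_simp
    ring
  have hnn : 0 ≤ (X - 2 * Y * r * L) ^ 2 / (2 * r * L ^ 2) := by positivity
  linarith

/-- The log-Hardy weight is continuous on `[ε, a] ⊂ (0, 1)`. [folklore] -/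
theorem continuousOn_inv_mul_log_sq {ε a : ℝ} (hε : 0 < ε) (ha : a < 1) :
    ContinuousOn (fun r : ℝ => r⁻¹ / Real.log r ^ 2) (Icc ε a) := by
  intro r hr
  have hr0 : 0 < r := hε.trans_le hr.1
  have hr1 : r ≠ 1 := (hr.2.trans_lt ha).ne
  have hlog : Real.log r ≠ 0 := Real.log_ne_zero_of_pos_of_ne_one hr0 hr1
  exact ((continuousAt_inv₀ hr0.ne').div ((Real.continuousAt_log hr0.ne').pow 2)
    (pow_ne_zero 2 hlog)).continuousWithinAt

/-! ### The truncated inequality on `[ε, a]` -/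

/-- **The logarithmic Hardy inequality on `[ε, a]`, `0 < ε ≤ a < 1`** (the integration by parts of
Lei–Zhang 2017, proof of Cor. 1.3, arXiv p. 7, with the boundary term kept and the factor `2`
of `d‖h‖² = 2⟪h, h'⟫` restored): for `h ∈ C¹(ℝ; F)`,
`∫_ε^a ‖h‖²/(r log² r) ≤ 2‖h a‖²/|log a| + 4 ∫_ε^a ‖h'‖² r`. [cite: LeiZhang2017, proof of Cor. 1.3 (arXiv p. 7)] -/
theorem logHardy_trunc {h : ℝ → F} (hh : ContDiff ℝ 1 h) {ε a : ℝ} (hε : 0 < ε) (hεa : ε ≤ a)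
    (ha : a < 1) :
    ∫ r in ε..a, ‖h r‖ ^ 2 / (r * Real.log r ^ 2) ≤
      2 * ‖h a‖ ^ 2 / |Real.log a| + 4 * ∫ r in ε..a, ‖deriv h r‖ ^ 2 * r := by
  have hd : Differentiable ℝ h := hh.differentiable one_ne_zero
  have hdc : Continuous (deriv h) := hh.continuous_deriv_one
  have hIcc : uIcc ε a = Icc ε a := uIcc_of_le hεa
  have hpos : ∀ r ∈ Icc ε a, 0 < r := fun r hr => hε.trans_le hr.1
  have hlt1 : ∀ r ∈ Icc ε a, r < 1 := fun r hr => hr.2.trans_lt ha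
  have hlogneg : ∀ r ∈ Icc ε a, Real.log r < 0 := fun r hr =>
    Real.log_neg (hpos r hr) (hlt1 r hr)
  -- the functions of the integration by parts
  set u : ℝ → ℝ := fun r => ‖h r‖ ^ 2 with hu
  set u' : ℝ → ℝ := fun r => 2 * ⟪h r, deriv h r⟫ with hu'
  set v : ℝ → ℝ := fun r => -(Real.log r)⁻¹ with hv
  set v' : ℝ → ℝ := fun r => r⁻¹ / Real.log r ^ 2 with hv'
  have hu_deriv : ∀ r ∈ uIcc ε a, HasDerivAt u (u' r) r := fun r _ =>
    (hd r).hasDerivAt.norm_sq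
  have hv_deriv : ∀ r ∈ uIcc ε a, HasDerivAt v (v' r) r := fun r hr => by
    rw [hIcc] at hr
    exact hasDerivAt_neg_inv_log (hpos r hr) (hlt1 r hr).ne
  have hu'c : Continuous u' := continuous_const.mul (hh.continuous.inner hdc)
  have hu'i : IntervalIntegrable u' volume ε a := hu'c.intervalIntegrable _ _
  have hv'c : ContinuousOn v' (uIcc ε a) := by
    rw [hIcc]; exact continuousOn_inv_mul_log_sq hε ha
  have hv'i : IntervalIntegrable v' volume ε a := hv'c.intervalIntegrable
  have huc : Continuous u := (hh.continuous.norm).pow 2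
  have hvc : ContinuousOn v (uIcc ε a) := fun r hr =>
    (hv_deriv r hr).continuousAt.continuousWithinAt
  -- integration by parts
  have hparts := integral_mul_deriv_eq_deriv_mul hu_deriv hv_deriv hu'i hv'i
  -- the left side is `∫ u v'`
  have hL : ∫ r in ε..a, ‖h r‖ ^ 2 / (r * Real.log r ^ 2) = ∫ r in ε..a, u r * v' r :=
    integral_congr fun r _ => by simp only [hu, hv']; ring
  -- boundary terms
  have hva : v a = |Real.log a|⁻¹ := by
    have hla : Real.log a < 0 := hlogneg a ⟨hεa, le_rfl⟩
    simp only [hv, abs_of_neg hla, inv_neg]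
  have hbε : 0 ≤ u ε * v ε := by
    have hlε : Real.log ε < 0 := hlogneg ε ⟨le_rfl, hεa⟩
    have : 0 < v ε := by simp only [hv]; exact neg_pos.2 (inv_lt_zero.2 hlε)
    exact mul_nonneg (sq_nonneg _) this.le
  -- the cross term, pointwise
  have hcross : ∀ r ∈ Icc ε a, -(u' r * v r) ≤
      (1 / 2) * (u r * v' r) + 2 * (‖deriv h r‖ ^ 2 * r) := by
    intro r hr
    have hr0 := hpos r hr
    have hL0 : 0 < |Real.log r| := abs_pos.2 (hlogneg r hr).ne
    have h1 : -(u' r * v r) ≤ 2 * ‖h r‖ * ‖deriv h r‖ / |Real.log r| := by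
      have e : -(u' r * v r) = -(2 * ⟪h r, deriv h r⟫) * |Real.log r|⁻¹ := by
        simp only [hu', hv]
        rw [abs_of_neg (hlogneg r hr), inv_neg]
        ring
      rw [e, div_eq_mul_inv]
      have hinner : -(2 * ⟪h r, deriv h r⟫) ≤ 2 * ‖h r‖ * ‖deriv h r‖ := by
        have := (abs_le.1 (abs_real_inner_le_norm (h r) (deriv h r))).1
        linarith
      exact mul_le_mul_of_nonneg_right hinner (inv_nonneg.2 hL0.le)
    have h2 := two_mul_mul_div_le (X := ‖h r‖) (Y := ‖deriv h r‖) hr0 hL0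
    have e2 : ‖h r‖ ^ 2 / (2 * r * |Real.log r| ^ 2) = (1 / 2) * (u r * v' r) := by
      simp only [hu, hv', sq_abs]
      field_simp
    rw [e2, mul_assoc (2 : ℝ) (‖deriv h r‖ ^ 2) r] at h2
    exact h1.trans h2
  -- integrate the pointwise bound
  have hint_cross : ∫ r in ε..a, -(u' r * v r) ≤
      ∫ r in ε..a, ((1 / 2) * (u r * v' r) + 2 * (‖deriv h r‖ ^ 2 * r)) := by
    refine integral_mono_on hεa ?_ ?_ fun r hr => hcross r hr
    · exact ((hu'i.mul_continuousOn hvc).neg)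
    · refine IntervalIntegrable.add ?_ ?_
      · exact ((huc.intervalIntegrable _ _).mul_continuousOn hv'c).const_mul _
      · exact (((hdc.norm.pow 2).mul continuous_id).intervalIntegrable _ _).const_mul _
  have hsplit : ∫ r in ε..a, ((1 / 2) * (u r * v' r) + 2 * (‖deriv h r‖ ^ 2 * r)) =
      (1 / 2) * (∫ r in ε..a, u r * v' r) + 2 * ∫ r in ε..a, ‖deriv h r‖ ^ 2 * r := by
    rw [intervalIntegral.integral_add, intervalIntegral.integral_const_mul,
      intervalIntegral.integral_const_mul]
    · exact ((huc.intervalIntegrable _ _).mul_continuousOn hv'c).const_mul _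
    · exact (((hdc.norm.pow 2).mul continuous_id).intervalIntegrable _ _).const_mul _
  have hneg : ∫ r in ε..a, -(u' r * v r) = -∫ r in ε..a, u' r * v r := integral_neg
  -- assemble
  rw [hL]
  rw [hva] at hparts
  have hb : u a * |Real.log a|⁻¹ = ‖h a‖ ^ 2 / |Real.log a| := by
    simp only [hu, div_eq_mul_inv]
  rw [hneg, hsplit] at hint_cross
  have e3 : 2 * ‖h a‖ ^ 2 / |Real.log a| = 2 * (‖h a‖ ^ 2 / |Real.log a|) := by ring
  rw [e3]
  linarith

/-! ### The inequality on `(0, a)` -/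

/-- **The logarithmic Hardy inequality on `(0, a)`, `0 < a < 1`** (Lei–Zhang 2017, proof of
Cor. 1.3, arXiv p. 7; constant `4`, boundary term kept): for `h ∈ C¹(ℝ; F)` the function
`‖h‖²/(r log² r)` is integrable on `(0, a)` and
`∫_0^a ‖h‖²/(r log² r) ≤ 2‖h a‖²/|log a| + 4 ∫_0^a ‖h'‖² r`. [cite: LeiZhang2017, proof of Cor. 1.3 (arXiv p. 7)] -/
theorem logHardy {h : ℝ → F} (hh : ContDiff ℝ 1 h) {a : ℝ} (ha0 : 0 < a) (ha1 : a < 1) :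
    IntervalIntegrable (fun r => ‖h r‖ ^ 2 / (r * Real.log r ^ 2)) volume 0 a ∧
    ∫ r in 0..a, ‖h r‖ ^ 2 / (r * Real.log r ^ 2) ≤
      2 * ‖h a‖ ^ 2 / |Real.log a| + 4 * ∫ r in 0..a, ‖deriv h r‖ ^ 2 * r := by
  have hdc : Continuous (deriv h) := hh.continuous_deriv_one
  set f : ℝ → ℝ := fun r => ‖h r‖ ^ 2 / (r * Real.log r ^ 2) with hf
  set g : ℝ → ℝ := fun r => ‖deriv h r‖ ^ 2 * r with hg
  have hgc : Continuous g := (hdc.norm.pow 2).mul continuous_id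
  have hgi : ∀ b c : ℝ, IntervalIntegrable g volume b c := fun b c => hgc.intervalIntegrable _ _
  set B : ℝ := 2 * ‖h a‖ ^ 2 / |Real.log a| + 4 * ∫ r in 0..a, g r with hB
  -- nonnegativity of the integrand on `(0, 1)`
  have hf_nonneg : ∀ r, 0 < r → 0 ≤ f r := fun r hr => by
    simp only [hf]; positivity
  -- continuity of the integrand on `[ε, a]`
  have hfc : ∀ ε, 0 < ε → ContinuousOn f (Icc ε a) := fun ε hε => by
    have h1 : ContinuousOn (fun r => ‖h r‖ ^ 2 * (r⁻¹ / Real.log r ^ 2)) (Icc ε a) :=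
      ((hh.continuous.norm.pow 2).continuousOn).mul (continuousOn_inv_mul_log_sq hε ha1)
    refine h1.congr fun r _ => ?_
    simp only [hf]; ring
  -- the uniform bound on `[ε, a]`
  have hg_nonneg : 0 ≤ᵐ[volume.restrict (Ioc 0 a)] g :=
    (ae_restrict_iff' measurableSet_Ioc).2 (Eventually.of_forall fun r hr => by
      simp only [hg, Pi.zero_apply]
      exact mul_nonneg (sq_nonneg _) hr.1.le)
  have hbound : ∀ ε ∈ Ioo 0 a, ∫ r in ε..a, f r ≤ B := by
    intro ε hε
    have h1 := logHardy_trunc hh hε.1 hε.2.le ha1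
    have h2 : ∫ r in ε..a, g r ≤ ∫ r in 0..a, g r :=
      integral_mono_interval hε.1.le hε.2.le le_rfl hg_nonneg (hgi 0 a)
    simp only [hB, hf, hg] at h1 h2 ⊢
    linarith
  -- a sequence of truncation radii `s n → 0⁺`
  set s : ℕ → ℝ := fun n => (a / 2) * (1 / ((n : ℝ) + 1)) with hs
  have hs_pos : ∀ n, 0 < s n := fun n => by simp only [hs]; positivity
  have hs_lt : ∀ n, s n < a := fun n => by
    have h1 : 1 / ((n : ℝ) + 1) ≤ 1 := by
      rw [div_le_one (by positivity)]; linarith [(n.cast_nonneg : (0 : ℝ) ≤ n)]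
    have h2 : s n ≤ a / 2 := by
      simp only [hs]
      exact mul_le_of_le_one_right (by positivity) h1
    linarith
  have hs_tend : Tendsto s atTop (𝓝 0) := by
    have := (tendsto_const_nhds (x := a / 2)).mul tendsto_one_div_add_atTop_nhds_zero_nat
    rw [mul_zero] at this
    exact this
  -- integrability on `(0, a]`
  have hInt : IntegrableOn f (Ioc 0 a) := by
    refine integrableOn_Ioc_of_intervalIntegral_norm_bounded_left (l := atTop) (I := B)
      (fun n => ((hfc (s n) (hs_pos n)).integrableOn_Icc).mono_set Ioc_subset_Icc_self)
      hs_tend (Eventually.of_forall fun n => ?_)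
    have heq : ∫ x in Ioc (s n) a, ‖f x‖ = ∫ x in (s n)..a, f x := by
      rw [integral_of_le (hs_lt n).le]
      refine setIntegral_congr_fun measurableSet_Ioc fun x hx => ?_
      exact Real.norm_of_nonneg (hf_nonneg x ((hs_pos n).trans hx.1))
    rw [heq]
    exact hbound (s n) ⟨hs_pos n, hs_lt n⟩
  have hII : IntervalIntegrable f volume 0 a :=
    (intervalIntegrable_iff_integrableOn_Ioc_of_le ha0.le).2 hInt
  refine ⟨hII, ?_⟩
  -- the primitive `x ↦ ∫_x^a f` is continuous on `[0, a]`; evaluate the bound along `s n`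
  have hIcc : IntegrableOn f (uIcc 0 a) := by
    rw [uIcc_of_le ha0.le]
    exact (integrableOn_Icc_iff_integrableOn_Ioc (by simp)).2 hInt
  have hcont := continuousOn_primitive_interval_left hIcc
  have h0 : (0 : ℝ) ∈ uIcc 0 a := by rw [uIcc_of_le ha0.le]; exact ⟨le_rfl, ha0.le⟩
  have htend : Tendsto (fun n => ∫ t in (s n)..a, f t) atTop (𝓝 (∫ t in (0 : ℝ)..a, f t)) := by
    have hc := (hcont 0 h0).tendsto
    refine hc.comp (tendsto_nhdsWithin_iff.2 ⟨hs_tend, Eventually.of_forall fun n => ?_⟩)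
    rw [uIcc_of_le ha0.le]
    exact ⟨(hs_pos n).le, (hs_lt n).le⟩
  exact le_of_tendsto' htend fun n => hbound (s n) ⟨hs_pos n, hs_lt n⟩

/-- **The printed form of the log-Hardy inequality** (Lei–Zhang 2017, proof of Cor. 1.3, arXiv
p. 7, constant corrected to `4`): for `h ∈ C¹(ℝ; F)` vanishing at `a ∈ (0, 1)`,
`∫_0^a ‖h‖²/(r log² r) ≤ 4 ∫_0^a ‖h'‖² r`. [cite: LeiZhang2017, proof of Cor. 1.3 (arXiv p. 7)] -/
theorem logHardy_of_eq_zero {h : ℝ → F} (hh : ContDiff ℝ 1 h) {a : ℝ} (ha0 : 0 < a)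
    (ha1 : a < 1) (h0 : h a = 0) :
    ∫ r in 0..a, ‖h r‖ ^ 2 / (r * Real.log r ^ 2) ≤ 4 * ∫ r in 0..a, ‖deriv h r‖ ^ 2 * r := by
  have h := (logHardy hh ha0 ha1).2
  rw [h0, norm_zero] at h
  simpa using h

/-- **The log-Hardy inequality in `ℝ≥0∞`** (same statement, lower Lebesgue integrals over
`(0, a]`; Lei–Zhang 2017, proof of Cor. 1.3, arXiv p. 7, constant `4`). [cite: LeiZhang2017, proof of Cor. 1.3 (arXiv p. 7)] -/
theorem lintegral_logHardy {h : ℝ → F} (hh : ContDiff ℝ 1 h) {a : ℝ} (ha0 : 0 < a)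
    (ha1 : a < 1) :
    ∫⁻ r in Ioc 0 a, ENNReal.ofReal (‖h r‖ ^ 2 / (r * Real.log r ^ 2)) ≤
      ENNReal.ofReal (2 * ‖h a‖ ^ 2 / |Real.log a|) +
        4 * ∫⁻ r in Ioc 0 a, ENNReal.ofReal (‖deriv h r‖ ^ 2 * r) := by
  obtain ⟨hfi, hle⟩ := logHardy hh ha0 ha1
  have hInt : IntegrableOn (fun r => ‖h r‖ ^ 2 / (r * Real.log r ^ 2)) (Ioc 0 a) :=
    (intervalIntegrable_iff_integrableOn_Ioc_of_le ha0.le).1 hfi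
  have hgc : Continuous fun r => ‖deriv h r‖ ^ 2 * r :=
    ((hh.continuous_deriv_one).norm.pow 2).mul continuous_id
  have hgInt : IntegrableOn (fun r => ‖deriv h r‖ ^ 2 * r) (Ioc 0 a) :=
    (hgc.integrableOn_Icc (a := 0) (b := a)).mono_set Ioc_subset_Icc_self
  have hf_nonneg : 0 ≤ᵐ[volume.restrict (Ioc 0 a)] fun r => ‖h r‖ ^ 2 / (r * Real.log r ^ 2) :=
    (ae_restrict_iff' measurableSet_Ioc).2 (Eventually.of_forall fun r hr => by
      simp only [Pi.zero_apply]
      have := hr.1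
      positivity)
  have hg_nonneg : 0 ≤ᵐ[volume.restrict (Ioc 0 a)] fun r => ‖deriv h r‖ ^ 2 * r :=
    (ae_restrict_iff' measurableSet_Ioc).2 (Eventually.of_forall fun r hr => by
      simp only [Pi.zero_apply]
      exact mul_nonneg (sq_nonneg _) hr.1.le)
  have hg0 : 0 ≤ ∫ r in Ioc 0 a, ‖deriv h r‖ ^ 2 * r :=
    setIntegral_nonneg measurableSet_Ioc fun r hr => mul_nonneg (sq_nonneg _) hr.1.le
  rw [← ofReal_integral_eq_lintegral_ofReal hInt hf_nonneg,
    ← ofReal_integral_eq_lintegral_ofReal hgInt hg_nonneg, ← integral_of_le ha0.le,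
    ← integral_of_le ha0.le]
  rw [← integral_of_le ha0.le] at hg0
  calc ENNReal.ofReal (∫ r in 0..a, ‖h r‖ ^ 2 / (r * Real.log r ^ 2))
      ≤ ENNReal.ofReal (2 * ‖h a‖ ^ 2 / |Real.log a| + 4 * ∫ r in 0..a, ‖deriv h r‖ ^ 2 * r) :=
        ENNReal.ofReal_le_ofReal hle
    _ = ENNReal.ofReal (2 * ‖h a‖ ^ 2 / |Real.log a|) +
          4 * ENNReal.ofReal (∫ r in 0..a, ‖deriv h r‖ ^ 2 * r) := by
        rw [ENNReal.ofReal_add (by positivity) (by positivity), ENNReal.ofReal_mul (by norm_num),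
          ENNReal.ofReal_ofNat]

end Literature.Analysis.FluidPDE

end
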